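import Mathlib
import HarnessLib
import Summits.ValiantsHypothesis.ValiantsHypothesis.Theorems.MonotoneRestorationOrbitRestorationQPBooleanWidthCollapse
import Summits.ValiantsHypothesis.ValiantsHypothesis.Theorems.MonotoneRestorationOrbitRestorationQPValueOrbitPer

/-!
# Route MonotoneRestoration, crux `OrbitRestorationQP` (stmt-18293) — A BOOLEAN-BLIND MATRIX-SYMMETRIC FAMILY WITHOUT
# QUASI-POLYNOMIAL-ORBIT SYMMETRIC CIRCUITS (helper, def-free)

Dawar–Pago–Seppelt (ITCS 2026, p. 5) ask whether bounded counting width suffices for orbit-small symmetric circuits.  In the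
BOOLEAN reading of counting width (values at `0/1` adjacency matrices of simple graphs; the currency of the simple-graph cut
`W₁`/`H₁` of p825758/p825944 and of the in-tree kill pipeline) the answer is NO, unconditionally, for a matrix-symmetric
p-family in `VNP`:

* `exists_booleanBlind_not_qpOrbit` — the family `E_n · per_n`, `E_n = Π_{j ≤ n²} (U_n − j)` (`…BooleanWidthCollapse.lean`),
  is invariant under independent row and column permutations, VANISHES AT EVERY `0/1` POINT (so its values on simple graphs are
  `C¹`-determined: counting width zero), and has NO square-symmetric circuits of quasi-polynomial orbit size: such circuits would,
  by exact division at the invariant base point `a ≡ 2` (`ValueOrbitDivision`, Strassen in orbit currency), give them for the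
  permanent, contradicting Dawar–Wilsenach Thm 7.1 (PROVED in the tree, `DawarWilsenach2025_thm71_holds`, via
  `ValueOrbit.perPoly_not_valueOrbitQP`).
* `booleanW_false_without_VP` — hence the Boolean circuit half `W₁` WITHOUT its `VP` hypothesis is FALSE (as it must be, `W₁`
  being equivalent to L1 by `orbitRestorationQP_of_booleanW`, whose `VP` hypothesis is load-bearing by the permanent): Boolean
  counting width does not control orbit complexity; only the `VP` hypothesis (or a WEIGHTED width hypothesis) can.

Honest label: a certified remark (glue: collapse multiplier + division + DW 7.1); no stub closed; VP ≠ VNP untouched.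
[cite: DawarWilsenach2025, Thm 7.1 (p. 18); Strassen1973, Satz 1]
-/

-- `Summit.ValiantsHypothesis.ValiantsHypothesis.…` is the tree's mandated namespace (Sub = Summit).
set_option linter.dupNamespace false

noncomputable section

open scoped Classical

namespace Summit.ValiantsHypothesis.ValiantsHypothesis.Theorems

namespace BooleanWidthCollapse

open MvPolynomial Finset
open Summit.ValiantsHypothesis.ValiantsHypothesis.Theses.MonotoneRestoration
open Literature.Computability.AlgebraicComplexity
open Literature.ModelTheory.FiniteModelTheory
open MonotoneRestorationQPLinearWidth OrbitRestorationQPDepthThreeRung LevelStructure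

/-- **The permanent is not quasi-polynomially orbit-restorable** (Dawar–Wilsenach Thm 7.1, in line vocabulary). [cite: DawarWilsenach2025, Thm 7.1 (p. 18)] -/
theorem not_qpOrbitRestorable_perPoly : ¬ ∃ c : ℕ, ∀ n : ℕ, QPOrbitRestorable c n (perPoly (Fin n) ℂ) := by
  rintro ⟨c, hc⟩
  refine ValueOrbit.perPoly_not_valueOrbitQP c fun n => ?_
  obtain ⟨-, 𝒟, hmem, hS⟩ := ValueOrbit.exists_valueDerivation_of_qpOrbitRestorable (hc n)
  exact ⟨𝒟, hmem, hS⟩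

/-- **A BOOLEAN-BLIND MATRIX-SYMMETRIC FAMILY WITH NO QUASI-POLYNOMIAL-ORBIT SYMMETRIC CIRCUITS**: `E · per` vanishes at every
`0/1` point and is not orbit-restorable with any constant. [cite: DawarWilsenach2025, Thm 7.1 (p. 18)] -/
theorem exists_booleanBlind_not_qpOrbit :
    ∃ f : (n : ℕ) → MvPolynomial (Fin n × Fin n) ℂ,
      (∀ (n : ℕ) (σ τ : Equiv.Perm (Fin n)),
        MvPolynomial.rename (fun p : Fin n × Fin n => (σ p.1, τ p.2)) (f n) = f n) ∧
      (∀ (n : ℕ) (S : Set (Fin n × Fin n)), eval (Set.indicator S (1 : Fin n × Fin n → ℂ)) (f n) = 0) ∧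
      ¬ ∃ c : ℕ, ∀ n : ℕ, QPOrbitRestorable c n (f n) := by
  -- matrix symmetry of the permanent over `ℂ` (from the `ℝ≥0` statement of the refuter file `LoadBearing`; the same
  -- fact is `OrbitRestorationLinearVolumeQPVHStrength.rename_perm_perPoly`, not imported to keep the cone small)
  have hper : ∀ (n : ℕ) (σ τ : Equiv.Perm (Fin n)),
      MvPolynomial.rename (fun p : Fin n × Fin n => (σ p.1, τ p.2)) (perPoly (Fin n) ℂ) = perPoly (Fin n) ℂ := by
    intro n σ τ
    have h' := congrArg (MvPolynomial.map (Complex.ofRealHom.comp NNReal.toRealHom))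
      (MonotoneRestorationQP.Negative.rename_perm_perPoly n σ τ)
    rw [MvPolynomial.map_rename, map_perPoly] at h'
    exact h'
  refine ⟨fun n => (∏ j ∈ range (n * n + 1), (U n - C (j : ℂ))) * perPoly (Fin n) ℂ,
    fun n σ τ => by rw [map_mul, rename_E, hper],
    fun n S => by rw [map_mul, eval_indicator_E, zero_mul], ?_⟩
  rintro ⟨c, hc⟩
  refine not_qpOrbitRestorable_perPoly ⟨max c 5 + 38, fun n => ?_⟩
  rcases Nat.eq_zero_or_pos n with hn | hn
  · subst hn
    have hinv : ∀ σ : Equiv.Perm (Fin 0), ren σ (perPoly (Fin 0) ℂ) = perPoly (Fin 0) ℂ := fun σ => by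
      rw [ValueOrbit.ren_eq_of_matrixSymmetric (hper 0)]
    exact Restorable.qpOrbitRestorable_mono (by simp) (Restorable.qpOrbitRestorable_of_invariant _ hinv)
  · exact ValueOrbitDivision.qpOrbitRestorable_of_mul_eq_of_eval_ne_zero
      (F := (∏ j ∈ range (n * n + 1), (U n - C (j : ℂ))) * perPoly (Fin n) ℂ)
      (D := ∏ j ∈ range (n * n + 1), (U n - C (j : ℂ))) (h := perPoly (Fin n) ℂ) rfl (fun _ => (2 : ℂ))
      (fun _ _ => rfl) (eval_two_E_ne_zero hn)
      (Restorable.qpOrbitRestorable_mono (le_max_left _ _) (hc n))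
      (Restorable.qpOrbitRestorable_mono (show 5 ≤ max c 5 from le_max_right _ _) (qpOrbitRestorable_E n))

/-- **`W₁` WITHOUT ITS `VP` HYPOTHESIS IS FALSE**: Boolean determinedness on simple graphs (even vanishing at all `0/1` points)
does not give quasi-polynomial-orbit symmetric circuits for matrix-symmetric families in general. [cite: DawarWilsenach2025, Thm 7.1 (p. 18)] -/
theorem booleanW_false_without_VP :
    ¬ ∀ f : (n : ℕ) → MvPolynomial (Fin n × Fin n) ℂ, IsMatrixSymmetric f →
      (∃ c N : ℕ, ∀ m : ℕ, N ≤ m → ∀ X Y : SimpleGraph (Fin m),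
        CkEquiv ((Nat.log 2 m + c) ^ c) X Y →
          MvPolynomial.eval (Set.indicator {ij : Fin m × Fin m | X.Adj ij.1 ij.2} 1) (f m) =
            MvPolynomial.eval (Set.indicator {ij : Fin m × Fin m | Y.Adj ij.1 ij.2} 1) (f m)) →
      QPOrbitSymm f := by
  intro hW
  obtain ⟨f, hsymm, hzero, hnot⟩ := exists_booleanBlind_not_qpOrbit
  refine hnot ?_
  obtain ⟨c, hc⟩ := hW f hsymm ⟨0, 0, fun m _ X Y _ => by rw [hzero, hzero]⟩
  exact ⟨c, fun n => hc n⟩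

end BooleanWidthCollapse

end Summit.ValiantsHypothesis.ValiantsHypothesis.Theorems

end
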